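import Literature.Computability.Cryptography.LWEPrimePowerAmplifier
import Literature.Probability.Distributions.ProductLawEvents
import HarnessLib

/-!
# Selecting the best of finitely many `LWE` distinguishers, with its polarity, by self-generated estimation

Topic `Computability/Cryptography` (LWE), grouping namespace `LWE`. Proved glue (no named fact) towards
`Literature.Computability.Cryptography.blprs_gapSVP_sqrt_dim_to_lwe_classical` (**pqc.S21**),
hypothesis `h₃` of `BLPRSReduction.lean`. BLPRS 2013, Thm. 4.1 produces THREE reductions and guarantees
only that *"at least one of the three reductions produces an algorithm … with advantage at least …"*
(arXiv:1306.0281, p. 13); a single uniform reduction therefore first MEASURES the candidates on instances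
it generates itself — decision-`LWE` instances with a self-chosen uniform secret versus uniform samples,
exactly as in the estimation steps of Regev's Lemma 4.1 (*"estimate … by a standard Chernoff bound"*) —
and then runs the empirically best candidate, flipping its answer if its empirical signed advantage is
negative. This file proves the law-level analysis of that selection for `k + 1` candidate tests
`E i : Distinguisher ι R m` against `LWE_{χ}` with uniform secret on `m` samples:

* `sAdv χ m D` — the SIGNED advantage `Pr[D(A_{s,χ}^m), s ← U] - Pr[D(U^m)]`
  (`distinguishingAdvantage = |sAdv|`, `distinguishingAdvantage_eq_abs_sAdv`);
* `candEstLaw` (for each candidate, `N` verdicts on self-generated `LWE` tuples and `N` on uniform tuples,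
  all independent), `gHat` (empirical signed gaps), `selectIdx` (least index of maximal `|gHat|`),
  `selectNeg` (its sign), `selTest`, **`selectDistinguisher`** (estimate, then run the selected test,
  flipped if negative);
* averages: `sum_toReal_coe`, `abs_sum_toReal_mul_sub_le`, `pacc_bind_eq_sum`, `pacc_flip`
  (`Pr[¬D] = 1 - Pr[D]`), `sAdv_selTest` (`= ± sAdv (E i*)`), **`sAdv_selectDistinguisher`**
  (`= ∑_a candEstLaw(a) · sAdv (selTest a)`: the measurement is independent of the input);
* `CandGood` (every empirical frequency within `η/8`), `prob_not_candGood_le`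
  (`≤ (k+1) · 32/(Nη²)`, Chebyshev and a union bound), `sAdv_selTest_ge_of_candGood` (on a good
  measurement, if some candidate has advantage `≥ η`, the selected signed test has `sAdv ≥ η/2`);
* **`distinguishingAdvantage_selectDistinguisher_ge`**:
  `Adv[selectDistinguisher] ≥ η/2 - 2(k+1)·32/(Nη²)` whenever some candidate has `Adv ≥ η`.

## References

* Z. Brakerski, A. Langlois, C. Peikert, O. Regev, D. Stehlé, *Classical hardness of learning with errors*,
  STOC 2013; arXiv:1306.0281, Thm. 4.1 ("at least one of the three reductions …", p. 13). [BrakerskiEtAl2013]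
* O. Regev, *On lattices, learning with errors, random linear codes, and cryptography*, J. ACM 56 (2009),
  Lemma 4.1 (proof: estimating acceptance probabilities on self-generated instances). [RegevLWE2009]
-/

noncomputable section

open scoped ENNReal
open Literature.Probability.Distributions

namespace Literature.Computability.Cryptography

namespace LWE

open MP12

/-! ### Averages against a finite law -/

section Averages

variable {Ω : Type} [Fintype Ω]

/-- `∑_ω μ(ω) = 1` in `ℝ`. [folklore] -/
theorem sum_toReal_coe (μ : PMF Ω) : ∑ ω, (μ ω).toReal = 1 := by
  rw [← tsum_fintype (L := SummationFilter.unconditional _), PMF.tsum_coe_toReal]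

/-- **An average of `d`-close numbers is `d`-close**: `|∑ μ(ω) f(ω) - ∑ μ(ω) g(ω)| ≤ d` when `|f - g| ≤ d`
pointwise. [folklore] -/
theorem abs_sum_toReal_mul_sub_le (μ : PMF Ω) (f g : Ω → ℝ) {d : ℝ} (h : ∀ ω, |f ω - g ω| ≤ d) :
    |∑ ω, (μ ω).toReal * f ω - ∑ ω, (μ ω).toReal * g ω| ≤ d := by
  rw [← Finset.sum_sub_distrib]
  calc |∑ ω, ((μ ω).toReal * f ω - (μ ω).toReal * g ω)| ≤ ∑ ω, |(μ ω).toReal * f ω - (μ ω).toReal * g ω| :=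
        Finset.abs_sum_le_sum_abs _ _
    _ = ∑ ω, (μ ω).toReal * |f ω - g ω| := Finset.sum_congr rfl fun ω _ => by
        rw [← mul_sub, abs_mul, abs_of_nonneg ENNReal.toReal_nonneg]
    _ ≤ ∑ ω, (μ ω).toReal * d := Finset.sum_le_sum fun ω _ => mul_le_mul_of_nonneg_left (h ω) ENNReal.toReal_nonneg
    _ = d := by rw [← Finset.sum_mul, sum_toReal_coe, one_mul]

/-- The constant case: `|∑ μ(ω) f(ω) - c| ≤ d` when `|f - c| ≤ d` pointwise. [folklore] -/
theorem abs_sum_toReal_mul_sub_const_le (μ : PMF Ω) (f : Ω → ℝ) (c : ℝ) {d : ℝ} (h : ∀ ω, |f ω - c| ≤ d) :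
    |∑ ω, (μ ω).toReal * f ω - c| ≤ d := by
  have hc : c = ∑ ω, (μ ω).toReal * c := by rw [← Finset.sum_mul, sum_toReal_coe, one_mul]
  conv_lhs => rw [hc]
  exact abs_sum_toReal_mul_sub_le μ f (fun _ => c) h

/-- **The mass of an event as a weighted indicator sum.** [folklore] -/
theorem toReal_toOuterMeasure_eq_sum_mul_ite (μ : PMF Ω) (S : Set Ω) [DecidablePred (· ∈ S)] :
    (μ.toOuterMeasure S).toReal = ∑ ω, (μ ω).toReal * (if ω ∈ S then 1 else 0) := by
  rw [PMF.toOuterMeasure_apply, tsum_fintype, ENNReal.toReal_sum (fun ω _ => ?_)]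
  · refine Finset.sum_congr rfl fun ω _ => ?_
    by_cases h : ω ∈ S
    · rw [Set.indicator_of_mem h, if_pos h, mul_one]
    · rw [Set.indicator_of_notMem h, if_neg h, mul_zero, ENNReal.toReal_zero]
  · exact ne_top_of_le_ne_top (PMF.apply_ne_top μ ω) (Set.indicator_le_self _ _ ω)

/-- **Good/bad accounting of an average**: if `f ≥ c` off the bad event `B` and `f ≥ -1` everywhere,
then `∑ μ(ω) f(ω) ≥ c - (1 + c) · μ(B)`. [folklore] -/
theorem sum_toReal_mul_ge_of_good (μ : PMF Ω) (f : Ω → ℝ) (B : Set Ω) {c : ℝ}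
    (hgood : ∀ ω, ω ∉ B → c ≤ f ω) (hall : ∀ ω, -1 ≤ f ω) :
    c - (1 + c) * (μ.toOuterMeasure B).toReal ≤ ∑ ω, (μ ω).toReal * f ω := by
  classical
  rw [toReal_toOuterMeasure_eq_sum_mul_ite]
  have hpt : ∀ ω, (μ ω).toReal * (c - (1 + c) * (if ω ∈ B then 1 else 0)) ≤ (μ ω).toReal * f ω := by
    intro ω
    refine mul_le_mul_of_nonneg_left ?_ ENNReal.toReal_nonneg
    by_cases h : ω ∈ B
    · rw [if_pos h]; linarith [hall ω]
    · rw [if_neg h]; linarith [hgood ω h]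
  have hexp : ∑ ω, (μ ω).toReal * (c - (1 + c) * (if ω ∈ B then 1 else 0)) =
      c * ∑ ω, (μ ω).toReal - (1 + c) * ∑ ω, (μ ω).toReal * (if ω ∈ B then 1 else 0) := by
    rw [Finset.mul_sum, Finset.mul_sum, ← Finset.sum_sub_distrib]
    refine Finset.sum_congr rfl fun ω _ => ?_
    ring
  calc c - (1 + c) * ∑ ω, (μ ω).toReal * (if ω ∈ B then 1 else 0)
      = ∑ ω, (μ ω).toReal * (c - (1 + c) * (if ω ∈ B then 1 else 0)) := by rw [hexp, sum_toReal_coe, mul_one]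
    _ ≤ ∑ ω, (μ ω).toReal * f ω := Finset.sum_le_sum fun ω _ => hpt ω

/-- **Acceptance probability of a finite mixture** is the average of the acceptance probabilities. [folklore] -/
theorem pacc_bind_eq_sum {B : Type} (D : B → PMF Bool) (μ : PMF Ω) (f : Ω → PMF B) :
    pacc D (μ.bind f) = ∑ ω, (μ ω).toReal * pacc D (f ω) := by
  unfold pacc
  rw [PMF.bind_bind, PMF.bind_apply, tsum_fintype, ENNReal.toReal_sum (fun ω _ =>
    ENNReal.mul_ne_top (PMF.apply_ne_top _ _) (PMF.apply_ne_top _ _))]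
  exact Finset.sum_congr rfl fun ω _ => ENNReal.toReal_mul

end Averages

/-! ### Signed advantage and flipping -/

section Signed

variable {ι : Type} [Fintype ι] [DecidableEq ι] {R : Type} [CommRing R] [Fintype R]

/-- **The signed advantage** `Pr_{s ← U}[D(A_{s,χ}^m)] - Pr[D(U^m)]`. [cite: RegevLWE2009, §4 (Lemma 4.1)] -/
def sAdv (χ : PMF R) (m : ℕ) (D : Distinguisher ι R m) : ℝ :=
  pacc D (lweSamplesUniformSecret χ m) - pacc D (uniformSamples ι R m)

/-- `Adv = |sAdv|`. [folklore] -/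
theorem distinguishingAdvantage_eq_abs_sAdv (χ : PMF R) (m : ℕ) (D : Distinguisher ι R m) :
    distinguishingAdvantage χ m D = |sAdv χ m D| := rfl

/-- `|sAdv| ≤ 1`. [folklore] -/
theorem abs_sAdv_le_one (χ : PMF R) (m : ℕ) (D : Distinguisher ι R m) : |sAdv χ m D| ≤ 1 := by
  unfold sAdv
  have h1 := pacc_mem_Icc D (lweSamplesUniformSecret χ m)
  have h2 := pacc_mem_Icc D (uniformSamples ι R m)
  rw [abs_le]
  constructor <;> linarith [h1.1, h1.2, h2.1, h2.2]

/-- **Flipping the verdict complements the acceptance probability**: `Pr[¬D] = 1 - Pr[D]`. [folklore] -/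
theorem pacc_flip {B : Type} (D : B → PMF Bool) (P : PMF B) :
    pacc (fun b => (D b).map (fun x => !x)) P = 1 - pacc D P := by
  unfold pacc
  have hmap : (P.bind fun b => (D b).map (fun x => !x)) = (P.bind D).map (fun x => !x) := by
    rw [PMF.map_bind]
  rw [hmap, show ((P.bind D).map (fun x => !x)) true = (P.bind D) false by
    rw [← PMF.toOuterMeasure_apply_singleton, PMF.toOuterMeasure_map_apply]
    rw [show (fun x : Bool => !x) ⁻¹' {true} = {false} by ext x; cases x <;> simp, PMF.toOuterMeasure_apply_singleton]]
  have hsum : (P.bind D) false + (P.bind D) true = 1 := by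
    have := (P.bind D).tsum_coe
    rwa [tsum_bool] at this
  have hfin : (P.bind D) true ≠ ⊤ := PMF.apply_ne_top _ _
  have hfin' : (P.bind D) false ≠ ⊤ := PMF.apply_ne_top _ _
  have := congrArg ENNReal.toReal hsum
  rw [ENNReal.toReal_add hfin' hfin, ENNReal.toReal_one] at this
  linarith

/-- Flipping by a fixed Boolean: `xor` with `false` is the identity, with `true` the flip. [folklore] -/
theorem pacc_map_bne {B : Type} (D : B → PMF Bool) (P : PMF B) (σ : Bool) :
    pacc (fun b => (D b).map (fun x => x != σ)) P = if σ then 1 - pacc D P else pacc D P := by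
  cases σ
  · rw [if_neg (by decide)]
    have : (fun b => (D b).map (fun x => x != false)) = D := by
      funext b
      rw [show (fun x : Bool => x != false) = id by funext x; cases x <;> rfl, PMF.map_id]
    rw [this]
  · rw [if_pos rfl, ← pacc_flip]
    have : (fun x : Bool => x != true) = fun x => !x := by funext x; cases x <;> rfl
    rw [this]

end Signed

/-! ### The selection -/

section Select

variable {ι : Type} [Fintype ι] [DecidableEq ι] {R : Type} [CommRing R] [Fintype R]
variable (χ : PMF R) {m : ℕ} {k : ℕ} (E : Fin (k + 1) → Distinguisher ι R m) (N : ℕ)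

/-- **The measurement**: for each candidate, `N` verdicts on self-generated `LWE` tuples (uniform secret, noise
`χ`) and `N` verdicts on uniform tuples, everything independent. [cite: RegevLWE2009, Lemma 4.1 (proof: "estimate … using the LWE samples it generates itself")] -/
def candEstLaw : PMF (Fin (k + 1) → (Fin N → Bool) × (Fin N → Bool)) :=
  piLaw fun i => prodLaw (ansLaw (E i) (lweSamplesUniformSecret χ m) N) (ansLaw (E i) (uniformSamples ι R m) N)

/-- The empirical signed gap of candidate `i`. [folklore] -/
def gHat (a : Fin (k + 1) → (Fin N → Bool) × (Fin N → Bool)) (i : Fin (k + 1)) : ℝ :=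
  (cnt (a i).1 - cnt (a i).2) / N

/-- `i` has maximal empirical `|gap|`. [folklore] -/
def IsBestCand (a : Fin (k + 1) → (Fin N → Bool) × (Fin N → Bool)) (i : Fin (k + 1)) : Prop :=
  ∀ i', |gHat N a i'| ≤ |gHat N a i|

/-- Some candidate has maximal empirical `|gap|`. [folklore] -/
theorem exists_isBestCand (a : Fin (k + 1) → (Fin N → Bool) × (Fin N → Bool)) : ∃ i, IsBestCand N a i := by
  obtain ⟨i, -, hmax⟩ := Finset.exists_max_image Finset.univ (fun i => |gHat N a i|) Finset.univ_nonempty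
  exact ⟨i, fun i' => hmax i' (Finset.mem_univ _)⟩

open Classical in
/-- **The selected candidate**: the least index of maximal empirical `|gap|`. [cite: BrakerskiEtAl2013, Thm. 4.1 (selecting among the three reductions)] -/
def selectIdx (a : Fin (k + 1) → (Fin N → Bool) × (Fin N → Bool)) : Fin (k + 1) :=
  (Finset.univ.filter (IsBestCand N a)).min' (by
    obtain ⟨i, hi⟩ := exists_isBestCand N a
    exact ⟨i, Finset.mem_filter.2 ⟨Finset.mem_univ _, hi⟩⟩)

/-- The selected candidate is a best candidate. [folklore] -/
theorem isBestCand_selectIdx (a : Fin (k + 1) → (Fin N → Bool) × (Fin N → Bool)) : IsBestCand N a (selectIdx N a) := by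
  classical
  have h := Finset.min'_mem (Finset.univ.filter (IsBestCand N a)) (by
    obtain ⟨i, hi⟩ := exists_isBestCand N a
    exact ⟨i, Finset.mem_filter.2 ⟨Finset.mem_univ _, hi⟩⟩)
  unfold selectIdx
  convert (Finset.mem_filter.1 h).2

open Classical in
/-- **The polarity**: flip iff the selected empirical gap is negative. [folklore] -/
def selectNeg (a : Fin (k + 1) → (Fin N → Bool) × (Fin N → Bool)) : Bool :=
  decide (gHat N a (selectIdx N a) < 0)

/-- The selected, possibly flipped, candidate test. [folklore] -/
def selTest (a : Fin (k + 1) → (Fin N → Bool) × (Fin N → Bool)) : Distinguisher ι R m :=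
  fun S => (E (selectIdx N a) S).map fun x => x != selectNeg N a

/-- **The selecting distinguisher**: measure all candidates on self-generated instances, then run the empirically
best one on the input, flipped if its empirical gap is negative. [cite: BrakerskiEtAl2013, Thm. 4.1; RegevLWE2009, Lemma 4.1 (proof)] -/
def selectDistinguisher : Distinguisher ι R m :=
  fun S => (candEstLaw χ E N).bind fun a => selTest E N a S

/-- **The good measurement event**: all `2(k+1)` empirical frequencies are within `η/8` of their means. [folklore] -/
def CandGood (η : ℝ) (a : Fin (k + 1) → (Fin N → Bool) × (Fin N → Bool)) : Prop :=
  ∀ i, |cnt (a i).1 - N * pacc (E i) (lweSamplesUniformSecret χ m)| < N * (η / 8) ∧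
    |cnt (a i).2 - N * pacc (E i) (uniformSamples ι R m)| < N * (η / 8)

variable {χ E N}

/-- The signed advantage of the flipped-or-not selected test is `±` that of the selected candidate. [folklore] -/
theorem sAdv_selTest (a : Fin (k + 1) → (Fin N → Bool) × (Fin N → Bool)) :
    sAdv χ m (selTest E N a) = if selectNeg N a then -sAdv χ m (E (selectIdx N a)) else sAdv χ m (E (selectIdx N a)) := by
  unfold sAdv selTest
  rw [pacc_map_bne, pacc_map_bne]
  split_ifs <;> ring

/-- The acceptance probability of the selecting distinguisher is the measurement-average of the selected tests'.
[folklore] -/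
theorem pacc_selectDistinguisher (P : PMF (Fin m → (ι → R) × R)) :
    pacc (selectDistinguisher χ E N) P = ∑ a, (candEstLaw χ E N a).toReal * pacc (selTest E N a) P := by
  have h : P.bind (selectDistinguisher χ E N) = (candEstLaw χ E N).bind fun a => P.bind (selTest E N a) := by
    unfold selectDistinguisher
    rw [PMF.bind_comm]
  unfold pacc
  rw [h, PMF.bind_apply, tsum_fintype, ENNReal.toReal_sum (fun a _ =>
    ENNReal.mul_ne_top (PMF.apply_ne_top _ _) (PMF.apply_ne_top _ _))]
  exact Finset.sum_congr rfl fun a _ => ENNReal.toReal_mul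

/-- **The measurement is independent of the input**: `sAdv (selectDistinguisher) = ∑_a candEstLaw(a) · sAdv (selTest a)`.
[folklore] -/
theorem sAdv_selectDistinguisher :
    sAdv χ m (selectDistinguisher χ E N) = ∑ a, (candEstLaw χ E N a).toReal * sAdv χ m (selTest E N a) := by
  unfold sAdv
  rw [pacc_selectDistinguisher, pacc_selectDistinguisher, ← Finset.sum_sub_distrib]
  exact Finset.sum_congr rfl fun a _ => by ring

/-- **A bad measurement is unlikely**: `Pr[¬ CandGood η] ≤ (k+1) · 32/(Nη²)` (Chebyshev twice per candidate,
union bound). [cite: RegevLWE2009, Lemma 4.1 (proof: Chernoff/Chebyshev estimation)] -/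
theorem prob_not_candGood_le (hN : 0 < N) {η : ℝ} (hη : 0 < η) :
    (candEstLaw χ E N).toOuterMeasure {a | ¬ CandGood χ E N η a} ≤ (k + 1 : ℕ) * ENNReal.ofReal (32 / (N * η ^ 2)) := by
  have hη8 : 0 < η / 8 := by positivity
  set DevL : Fin (k + 1) → Set (Fin N → Bool) := fun i =>
    {b | (N : ℝ) * (η / 8) ≤ |cnt b - N * pacc (E i) (lweSamplesUniformSecret χ m)|} with hDevL
  set DevU : Fin (k + 1) → Set (Fin N → Bool) := fun i =>
    {b | (N : ℝ) * (η / 8) ≤ |cnt b - N * pacc (E i) (uniformSamples ι R m)|} with hDevU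
  have hset : {a : Fin (k + 1) → (Fin N → Bool) × (Fin N → Bool) | ¬ CandGood χ E N η a} ⊆
      {a | ∃ i, a i ∈ (Prod.fst ⁻¹' DevL i ∪ Prod.snd ⁻¹' DevU i)} := by
    intro a ha
    simp only [CandGood, not_forall, not_and_or, not_lt, Set.mem_setOf_eq] at ha
    obtain ⟨i, hi⟩ := ha
    refine ⟨i, ?_⟩
    rcases hi with h | h
    · exact Or.inl h
    · exact Or.inr h
  refine (MeasureTheory.measure_mono hset).trans ?_
  unfold candEstLaw
  refine (piLaw_toOuterMeasure_exists_mem_le _ _).trans ?_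
  have hi : ∀ i : Fin (k + 1), (prodLaw (ansLaw (E i) (lweSamplesUniformSecret χ m) N) (ansLaw (E i) (uniformSamples ι R m) N)).toOuterMeasure
      (Prod.fst ⁻¹' DevL i ∪ Prod.snd ⁻¹' DevU i) ≤ ENNReal.ofReal (32 / (N * η ^ 2)) := by
    intro i
    refine (MeasureTheory.measure_union_le _ _).trans ?_
    have e16 : ENNReal.ofReal (1 / (4 * N * (η / 8) ^ 2)) = ENNReal.ofReal (16 / (N * η ^ 2)) := by
      congr 1
      have hNr : (N : ℝ) ≠ 0 := by positivity
      field_simp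
      ring
    have e32 : ENNReal.ofReal (32 / (N * η ^ 2)) = ENNReal.ofReal (16 / (N * η ^ 2)) + ENNReal.ofReal (16 / (N * η ^ 2)) := by
      rw [← ENNReal.ofReal_add (by positivity) (by positivity)]
      congr 1
      ring
    rw [e32]
    refine add_le_add ?_ ?_
    · rw [← PMF.toOuterMeasure_map_apply, prodLaw_map_fst, ← e16]
      exact prob_cnt_dev_le (E i) _ hN hη8
    · rw [← PMF.toOuterMeasure_map_apply, prodLaw_map_snd, ← e16]
      exact prob_cnt_dev_le (E i) _ hN hη8
  calc ∑ i : Fin (k + 1), (prodLaw (ansLaw (E i) (lweSamplesUniformSecret χ m) N) (ansLaw (E i) (uniformSamples ι R m) N)).toOuterMeasure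
          (Prod.fst ⁻¹' DevL i ∪ Prod.snd ⁻¹' DevU i)
      ≤ ∑ _i : Fin (k + 1), ENNReal.ofReal (32 / (N * η ^ 2)) := Finset.sum_le_sum fun i _ => hi i
    _ = (k + 1 : ℕ) * ENNReal.ofReal (32 / (N * η ^ 2)) := by
        rw [Finset.sum_const, Finset.card_univ, Fintype.card_fin, nsmul_eq_mul]

/-- On a good measurement every empirical gap is within `η/4` of the signed advantage. [folklore] -/
theorem abs_gHat_sub_sAdv_lt (hN : 0 < N) {η : ℝ} {a : Fin (k + 1) → (Fin N → Bool) × (Fin N → Bool)}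
    (hgood : CandGood χ E N η a) (i : Fin (k + 1)) : |gHat N a i - sAdv χ m (E i)| < η / 4 := by
  have hNr : (0 : ℝ) < N := by exact_mod_cast hN
  obtain ⟨h1, h2⟩ := hgood i
  unfold gHat sAdv
  have hrew : (cnt (a i).1 - cnt (a i).2) / N - (pacc (E i) (lweSamplesUniformSecret χ m) - pacc (E i) (uniformSamples ι R m)) =
      ((cnt (a i).1 - N * pacc (E i) (lweSamplesUniformSecret χ m)) - (cnt (a i).2 - N * pacc (E i) (uniformSamples ι R m))) / N := by
    field_simp
    ring
  rw [hrew, abs_div, abs_of_pos hNr, div_lt_iff₀ hNr]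
  calc |cnt (a i).1 - N * pacc (E i) (lweSamplesUniformSecret χ m) - (cnt (a i).2 - N * pacc (E i) (uniformSamples ι R m))|
      ≤ |cnt (a i).1 - N * pacc (E i) (lweSamplesUniformSecret χ m)| + |cnt (a i).2 - N * pacc (E i) (uniformSamples ι R m)| := abs_sub _ _
    _ < N * (η / 8) + N * (η / 8) := add_lt_add h1 h2
    _ = η / 4 * N := by ring

/-- **On a good measurement the selected signed test is good**: if some candidate has `Adv ≥ η`, then
`sAdv (selTest a) ≥ η/2`. [cite: BrakerskiEtAl2013, Thm. 4.1 (selection among the reductions)] -/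
theorem sAdv_selTest_ge_of_candGood (hN : 0 < N) {η : ℝ} {a : Fin (k + 1) → (Fin N → Bool) × (Fin N → Bool)}
    (hgood : CandGood χ E N η a) (hbest : ∃ i, η ≤ distinguishingAdvantage χ m (E i)) :
    η / 2 ≤ sAdv χ m (selTest E N a) := by
  obtain ⟨i₀, hi₀⟩ := hbest
  rw [distinguishingAdvantage_eq_abs_sAdv] at hi₀
  set j := selectIdx N a with hj
  have hclose := fun i => abs_gHat_sub_sAdv_lt hN hgood i
  have hbestj : |gHat N a i₀| ≤ |gHat N a j| := isBestCand_selectIdx N a i₀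
  -- `|gHat j| ≥ 3η/4`
  have h0 : |sAdv χ m (E i₀)| - η / 4 < |gHat N a i₀| := by
    have := hclose i₀
    have := abs_sub_abs_le_abs_sub (sAdv χ m (E i₀)) (gHat N a i₀)
    rw [abs_sub_comm] at this
    linarith
  have hgj : 3 * η / 4 < |gHat N a j| := by linarith
  have hcj := hclose j
  rw [sAdv_selTest]
  unfold selectNeg
  by_cases hneg : gHat N a j < 0
  · rw [← hj, decide_eq_true hneg, if_pos rfl]
    rw [abs_of_neg hneg] at hgj
    have := (abs_lt.1 hcj).1
    linarith
  · rw [← hj, show decide (gHat N a j < 0) = false from decide_eq_false hneg]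
    simp only [Bool.false_eq_true, ↓reduceIte]
    rw [not_lt] at hneg
    rw [abs_of_nonneg hneg] at hgj
    have := (abs_lt.1 hcj).2
    linarith

/-- **The selecting distinguisher is good**: if some candidate has advantage `≥ η` (`η > 0`), then
`Adv[selectDistinguisher] ≥ sAdv ≥ η/2 - 2(k+1)·32/(Nη²)`. [cite: BrakerskiEtAl2013, Thm. 4.1; RegevLWE2009, Lemma 4.1 (proof)] -/
theorem distinguishingAdvantage_selectDistinguisher_ge (hN : 0 < N) {η : ℝ} (hη : 0 < η)
    (hbest : ∃ i, η ≤ distinguishingAdvantage χ m (E i)) :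
    η / 2 - 2 * ((k + 1 : ℕ) * (32 / (N * η ^ 2))) ≤ distinguishingAdvantage χ m (selectDistinguisher χ E N) := by
  rw [distinguishingAdvantage_eq_abs_sAdv]
  refine le_trans ?_ (le_abs_self _)
  rw [sAdv_selectDistinguisher]
  have hη1 : η ≤ 1 := by
    obtain ⟨i, hi⟩ := hbest
    rw [distinguishingAdvantage_eq_abs_sAdv] at hi
    exact hi.trans (abs_sAdv_le_one χ m (E i))
  -- good/bad accounting
  have hacc := sum_toReal_mul_ge_of_good (candEstLaw χ E N) (fun a => sAdv χ m (selTest E N a))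
    {a | ¬ CandGood χ E N η a} (c := η / 2)
    (fun a ha => sAdv_selTest_ge_of_candGood hN (by simpa using ha) hbest)
    (fun a => (abs_le.1 (abs_sAdv_le_one χ m (selTest E N a))).1)
  have hbad : ((candEstLaw χ E N).toOuterMeasure {a | ¬ CandGood χ E N η a}).toReal ≤ (k + 1 : ℕ) * (32 / (N * η ^ 2)) := by
    have h := prob_not_candGood_le (χ := χ) (E := E) hN hη
    have hfin : ((k + 1 : ℕ) : ℝ≥0∞) * ENNReal.ofReal (32 / (N * η ^ 2)) ≠ ⊤ :=
      ENNReal.mul_ne_top (ENNReal.natCast_ne_top _) ENNReal.ofReal_ne_top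
    calc ((candEstLaw χ E N).toOuterMeasure {a | ¬ CandGood χ E N η a}).toReal
        ≤ (((k + 1 : ℕ) : ℝ≥0∞) * ENNReal.ofReal (32 / (N * η ^ 2))).toReal := ENNReal.toReal_mono hfin h
      _ = (k + 1 : ℕ) * (32 / (N * η ^ 2)) := by
          rw [ENNReal.toReal_mul, ENNReal.toReal_natCast, ENNReal.toReal_ofReal (by positivity)]
  have h15 : (1 + η / 2) * ((candEstLaw χ E N).toOuterMeasure {a | ¬ CandGood χ E N η a}).toReal ≤
      2 * ((k + 1 : ℕ) * (32 / (N * η ^ 2))) := by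
    have h0 : 0 ≤ ((candEstLaw χ E N).toOuterMeasure {a | ¬ CandGood χ E N η a}).toReal := ENNReal.toReal_nonneg
    nlinarith
  linarith

end Select

end LWE

end Literature.Computability.Cryptography

end
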